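import Literature.RepresentationTheory.FiniteGroups.InducedRecognition
import Mathlib.RepresentationTheory.Subrepresentation
import Mathlib.RepresentationTheory.Invariants
import Mathlib.LinearAlgebra.Charpoly.ToMatrix
import HarnessLib

/-!
# The dimension of an induced representation and Serre's decomposition of `Ind π`

Topic `Literature/RepresentationTheory/FiniteGroups`, namespace `Literature.RepTheory`; continues
`Literature.RepresentationTheory.FiniteGroups.InducedRecognition`.  Serre, *Linear
Representations of Finite Groups*, §3.3: an induced representation `V = ⊕_{σ ∈ G/H} σ W` has
`dim V = (G : H) dim W`, and (§7.1) `Ind W = k[G] ⊗_{k[H]} W ≅ ⊕_{σ ∈ G/H} σ ⊗ W`.  For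
Mathlib's model `Representation.ind φ π` on `IndV φ π = (k[H] ⊗ A)_G` along an *injective*
`φ : G →* H` (the situation of `Literature.NumberTheory.GaloisRepresentations.ArtinRep.IsInducedFrom`: `φ = absGaloisRestrict K M`),
this file proves:

* `exists_indV_coeff` — the coefficient functionals `P_t : IndV φ π → A`,
  `P_t ⟦φ(g) t ⊗ a⟧ = π(g)⁻¹ a`, `P_t ⟦h ⊗ a⟧ = 0` for `h ∉ φ(G) t` (the components of
  `Ind ≅ ⊕_{φ(G)t} A`; compare Mathlib's `Rep.indToCoind` for subgroup inclusions);
* `le_finrank_indV`, **`finrank_indV_eq`**: `dim IndV φ π = [H : φ(G)] · dim A`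
  (with `finrank_indV_le` of `InducedRecognition`), and `indV_mk_injective`;
* for an equivalence `e : σ ≃ Ind π` (Mathlib `Representation.Equiv`) and the `G`-map
  `i = e⁻¹ ∘ (a ↦ ⟦1 ⊗ a⟧) : A → W`: `i` intertwines `π` with `σ ∘ φ`
  (`comp_indV_mk_one_intertwines`; in Mathlib's convention `h • ⟦h₁ ⊗ a⟧ = ⟦h₁h⁻¹ ⊗ a⟧`,
  `indV_mk_one_apply`), `W₀ = i(A)` is `φ(G)`-stable (`apply_mem_range_comp_indV_mk_one`),
  its translates span `W` (`iSup_map_range_comp_indV_mk_one`), `i` is injective and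
  `dim W = [H : φ(G)] dim W₀` (`finrank_eq_index_mul_finrank_range`) — i.e. `(σ, φ(G), W₀)`
  is an induced representation in the sense of Serre §3.3, the hypotheses `hspan`, `hdim` of
  `Literature.RepresentationTheory.FiniteGroups.InducedInvariantsCharpoly`;
* `charpoly_restrict_comap_eq` — transport of Euler factors along `i : A ≅ W₀`: for
  `J ≤ φ(G)` and `x ∈ G`, `charpoly(π(x) | A^{φ⁻¹J}) = charpoly(σ(φ x) | W₀ ∩ W^J)`
  (Neukirch VII (10.4) (iv), proof: "Conjugating by `τᵢ`, we obtain …").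

No definition is introduced (theorems only).

## Mathlib search

Mathlib (this pin) has `Representation.ind`, `IndV.mk`, `ind_mk`, `Coinvariants.lift`,
`Representation.Equiv`, `Rep.indCoindIso` (for `S.subtype`, `S : Subgroup G`, with a universe
restriction), `LinearMap.finrank_range_of_inj`, `LinearEquiv.charpoly_conj`, but no dimension
formula for `ind` along a homomorphism and no decomposition `Ind = ⊕ σW` (grep `finrank` in
`Mathlib/RepresentationTheory`: nothing on `ind`).

## References

* J.-P. Serre, *Linear Representations of Finite Groups*, GTM 42 (1977), §3.3 (induced
  representations, `dim V = (G:H) dim W`, Thm. 11) and §7.1 (`SerreLinearRepresentations1977`).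
* J. Neukirch, *Algebraic Number Theory* (1999), VII §10, proof of (10.4) (iv), pp. 523–524
  (`NeukirchANT1999`).
-/

namespace Literature.RepresentationTheory.FiniteGroups

open Representation TensorProduct

section Coeff

variable {k : Type*} [CommRing k] {G H : Type*} [Group G] [Group H] (φ : G →* H)
  {A : Type*} [AddCommGroup A] [Module k A] (π : Representation k G A)

/-- **Coefficient functionals on an induced module.**  For `φ : G →* H` injective and
`t ∈ H` there is a `k`-linear map `P_t : IndV φ π → A` with `P_t ⟦φ(g) t ⊗ a⟧ = π(g)⁻¹ a` and
`P_t ⟦h ⊗ a⟧ = 0` for `h ∉ φ(G) t` (the `t`-component of the isomorphism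
`Ind ≅ ⊕_{φ(G) t} A`, Serre §3.3 / §7.1; compare Mathlib's `Rep.indToCoind`).
[cite: SerreLinearRepresentations1977, §7.1] -/
theorem exists_indV_coeff (hφ : Function.Injective φ) (t : H) :
    ∃ P : IndV φ π →ₗ[k] A, (∀ (g : G) (a : A), P (IndV.mk φ π (φ g * t) a) = π g⁻¹ a) ∧
      ∀ (h : H) (a : A), h * t⁻¹ ∉ φ.range → P (IndV.mk φ π h a) = 0 := by
  classical
  -- the coefficient maps `c h : A → A`
  let c : H → (A →ₗ[k] A) := fun h =>
    if hh : h * t⁻¹ ∈ φ.range then π (Classical.choose hh)⁻¹ else 0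
  have hc_spec : ∀ (g : G), c (φ g * t) = π g⁻¹ := by
    intro g
    have hh : φ g * t * t⁻¹ ∈ φ.range := ⟨g, by rw [mul_inv_cancel_right]⟩
    simp only [c, dif_pos hh]
    have h1 : φ (Classical.choose hh) = φ g := by
      rw [Classical.choose_spec hh, mul_inv_cancel_right]
    rw [hφ h1]
  have hc_zero : ∀ h : H, h * t⁻¹ ∉ φ.range → c h = 0 := fun h hh => by
    simp only [c, dif_neg hh]
  have hc_mul : ∀ (g : G) (h : H), c (φ g * h) ∘ₗ π g = c h := by
    intro g h
    by_cases hh : h * t⁻¹ ∈ φ.range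
    · obtain ⟨g₀, hg₀⟩ := hh
      have hh' : h = φ g₀ * t := by rw [hg₀, inv_mul_cancel_right]
      rw [hh', ← mul_assoc, ← map_mul, hc_spec, hc_spec, mul_inv_rev, map_mul]
      change π g₀⁻¹ * π g⁻¹ * π g = π g₀⁻¹
      rw [mul_assoc, ← map_mul, inv_mul_cancel, map_one, mul_one]
    · have hh' : φ g * h * t⁻¹ ∉ φ.range := by
        intro hmem
        apply hh
        have : h * t⁻¹ = (φ g)⁻¹ * (φ g * h * t⁻¹) := by group
        rw [this]
        exact φ.range.mul_mem (φ.range.inv_mem ⟨g, rfl⟩) hmem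
      rw [hc_zero h hh, hc_zero _ hh', LinearMap.zero_comp]
  -- the bilinear map on `k[H] ⊗ A`
  let B : MonoidAlgebra k H →ₗ[k] A →ₗ[k] A :=
    (Finsupp.linearCombination k fun h : H => c h) ∘ₗ
      (MonoidAlgebra.coeffLinearEquiv k).toLinearMap
  have hB : ∀ (h : H) (r : k) (a : A), B (MonoidAlgebra.single h r) a = r • c h a := by
    intro h r a
    simp only [B, LinearMap.coe_comp, LinearEquiv.coe_coe, Function.comp_apply,
      MonoidAlgebra.coeffLinearEquiv_apply, MonoidAlgebra.coeff_single,
      Finsupp.linearCombination_single, LinearMap.smul_apply]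
  have hcoinv : ∀ g : G, TensorProduct.lift B ∘ₗ
      (Representation.tprod ((leftRegular k H).comp φ) π) g = TensorProduct.lift B := by
    intro g
    refine TensorProduct.ext' fun f a => ?_
    simp only [LinearMap.coe_comp, Function.comp_apply, tprod_apply, TensorProduct.map_tmul,
      TensorProduct.lift.tmul]
    induction f using MonoidAlgebra.induction_linear with
    | zero => simp only [map_zero, LinearMap.zero_apply]
    | add f₁ f₂ h₁ h₂ => simp only [map_add, LinearMap.add_apply, h₁, h₂]
    | single h r =>
      rw [MonoidHom.coe_comp, Function.comp_apply, ofMulAction_single, smul_eq_mul, hB, hB]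
      congr 1
      exact LinearMap.congr_fun (hc_mul g h) a
  refine ⟨Coinvariants.lift _ (TensorProduct.lift B) hcoinv, fun g a => ?_, fun h a hh => ?_⟩
  · change Coinvariants.lift _ _ hcoinv
      (Coinvariants.mk _ (MonoidAlgebra.single (φ g * t) (1 : k) ⊗ₜ[k] a)) = _
    rw [Coinvariants.lift_mk, TensorProduct.lift.tmul, hB, one_smul, hc_spec]
  · change Coinvariants.lift _ _ hcoinv
      (Coinvariants.mk _ (MonoidAlgebra.single h (1 : k) ⊗ₜ[k] a)) = _
    rw [Coinvariants.lift_mk, TensorProduct.lift.tmul, hB, one_smul, hc_zero h hh,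
      LinearMap.zero_apply]

end Coeff

section Dimension

variable {k : Type*} [Field k] {G H : Type*} [Group G] [Group H] (φ : G →* H)
  {A : Type*} [AddCommGroup A] [Module k A] (π : Representation k G A)

/-- **`dim Ind ≥ (H : φ(G)) · dim A`** for `φ` injective: the coefficient functionals
(`exists_indV_coeff`) at a system of right coset representatives give a surjection
`IndV φ π → (φ(G)\H → A)`.  With `finrank_indV_le` this is Serre's
`dim V = (G : H) dim W` (§3.3). [cite: SerreLinearRepresentations1977, §3.3] -/
theorem le_finrank_indV (hφ : Function.Injective φ) [FiniteDimensional k A]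
    [φ.range.FiniteIndex] :
    φ.range.index * Module.finrank k A ≤ Module.finrank k (IndV φ π) := by
  classical
  obtain ⟨hfin, -⟩ := finrank_indV_le (k := k) φ π
  set Q := Quotient (QuotientGroup.rightRel φ.range) with hQ
  haveI : Finite Q :=
    Finite.of_equiv _ (QuotientGroup.quotientRightRelEquivQuotientLeftRel φ.range).symm
  letI : Fintype Q := Fintype.ofFinite Q
  choose P hP hP0 using fun q : Q => exists_indV_coeff (k := k) φ π hφ q.out
  let Φ : IndV φ π →ₗ[k] (Q → A) := LinearMap.pi P
  have hout : ∀ q q' : Q, q ≠ q' → q.out * q'.out⁻¹ ∉ φ.range := by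
    intro q q' hqq' hmem
    apply hqq'
    rw [← Quotient.out_eq q, ← Quotient.out_eq q']
    exact Quotient.sound (QuotientGroup.rightRel_apply.mpr hmem) |>.symm
  have hsurj : Function.Surjective Φ := by
    intro F
    refine ⟨∑ q : Q, IndV.mk φ π q.out (F q), funext fun q' => ?_⟩
    simp only [Φ, LinearMap.pi_apply, map_sum]
    rw [Finset.sum_eq_single q']
    · have := hP q' 1 (F q')
      rwa [map_one, one_mul, inv_one, map_one, Module.End.one_apply] at this
    · intro q _ hq
      exact hP0 q' q.out (F q) (hout q q' hq)
    · intro h; exact absurd (Finset.mem_univ q') h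
  calc φ.range.index * Module.finrank k A = Module.finrank k (Q → A) := by
        rw [Module.finrank_pi_fintype, Finset.sum_const, Finset.card_univ, smul_eq_mul,
          Subgroup.index_eq_card, ← Nat.card_eq_fintype_card,
          Nat.card_congr (QuotientGroup.quotientRightRelEquivQuotientLeftRel φ.range)]
    _ ≤ Module.finrank k (IndV φ π) := LinearMap.finrank_le_finrank_of_surjective hsurj

/-- **Dimension of an induced representation** (Serre §3.3: `dim V = (G:H) dim W`): for `φ`
injective with image of finite index and `A` finite-dimensional,
`dim IndV φ π = [H : φ(G)] · dim A`. [cite: SerreLinearRepresentations1977, §3.3] -/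
theorem finrank_indV_eq (hφ : Function.Injective φ) [FiniteDimensional k A]
    [φ.range.FiniteIndex] :
    Module.finrank k (IndV φ π) = φ.range.index * Module.finrank k A :=
  le_antisymm (finrank_indV_le (k := k) φ π).2 (le_finrank_indV φ π hφ)

/-- The structure maps `a ↦ ⟦t ⊗ a⟧ : A → IndV φ π` are injective (for `φ` injective).
[cite: SerreLinearRepresentations1977, §7.1] -/
theorem indV_mk_injective (hφ : Function.Injective φ) (t : H) :
    Function.Injective (IndV.mk (k := k) φ π t) := by
  obtain ⟨P, hP, -⟩ := exists_indV_coeff (k := k) φ π hφ t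
  intro a b hab
  have := congrArg P hab
  have h1 := hP 1 a
  have h2 := hP 1 b
  rw [map_one, one_mul, inv_one, map_one, Module.End.one_apply] at h1 h2
  rwa [h1, h2] at this

end Dimension

section SerreDatum

variable {k : Type*} [Field k] {G H : Type*} [Group G] [Group H] (φ : G →* H)
  {A W : Type*} [AddCommGroup A] [Module k A] [AddCommGroup W] [Module k W]
  (π : Representation k G A) (σ : Representation k H W) (e : σ.Equiv (ind φ π))

/-- An equivalence `σ ≃ Ind π` intertwines pointwise. [folklore] -/
theorem equiv_apply_apply (h : H) (w : W) :
    e.toLinearEquiv (σ h w) = ind φ π h (e.toLinearEquiv w) :=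
  LinearMap.congr_fun (e.isIntertwining' h) w

/-- The inverse of an equivalence `σ ≃ Ind π` intertwines pointwise. [folklore] -/
theorem equiv_symm_apply_apply (h : H) (v : IndV φ π) :
    e.toLinearEquiv.symm (ind φ π h v) = σ h (e.toLinearEquiv.symm v) := by
  apply e.toLinearEquiv.injective
  rw [LinearEquiv.apply_symm_apply, equiv_apply_apply, LinearEquiv.apply_symm_apply]

/-- In Mathlib's model `Ind π = (k[H] ⊗ A)_G` (with `h • ⟦h₁ ⊗ a⟧ = ⟦h₁ h⁻¹ ⊗ a⟧`), the
structure map `a ↦ ⟦1 ⊗ a⟧` intertwines `π` with `Ind π ∘ φ`: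
`⟦1 ⊗ π(g) a⟧ = φ(g) • ⟦1 ⊗ a⟧`. [cite: SerreLinearRepresentations1977, §7.1] -/
theorem indV_mk_one_apply (g : G) (a : A) :
    IndV.mk (k := k) φ π 1 (π g a) = ind φ π (φ g) (IndV.mk φ π 1 a) := by
  rw [ind_mk, one_mul, ← map_inv]
  have := indV_mk_mul_apply (k := k) φ π g⁻¹ 1 (π g a)
  rw [mul_one, ← Module.End.mul_apply, ← map_mul, inv_mul_cancel, map_one,
    Module.End.one_apply] at this
  exact this.symm

/-- **The `G`-map `i = e⁻¹ ∘ (a ↦ ⟦1 ⊗ a⟧) : A → W` of an induced representation `σ ≃ Ind π`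
intertwines `π` with `σ ∘ φ`.** [cite: SerreLinearRepresentations1977, §7.1] -/
theorem comp_indV_mk_one_intertwines (g : G) :
    (e.toLinearEquiv.symm.toLinearMap ∘ₗ IndV.mk φ π 1) ∘ₗ π g =
      σ (φ g) ∘ₗ (e.toLinearEquiv.symm.toLinearMap ∘ₗ IndV.mk φ π 1) := by
  ext a
  change e.toLinearEquiv.symm (IndV.mk φ π 1 (π g a)) =
    σ (φ g) (e.toLinearEquiv.symm (IndV.mk φ π 1 a))
  rw [indV_mk_one_apply, equiv_symm_apply_apply]

/-- The image `W₀ = i(A)` is stable under `φ(G)`. [cite: SerreLinearRepresentations1977, §3.3] -/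
theorem apply_mem_range_comp_indV_mk_one {h : H} (hh : h ∈ φ.range) {w : W}
    (hw : w ∈ LinearMap.range (e.toLinearEquiv.symm.toLinearMap ∘ₗ IndV.mk φ π 1)) :
    σ h w ∈ LinearMap.range (e.toLinearEquiv.symm.toLinearMap ∘ₗ IndV.mk φ π 1) := by
  obtain ⟨g, rfl⟩ := hh
  obtain ⟨a, rfl⟩ := hw
  refine ⟨π g a, ?_⟩
  exact LinearMap.congr_fun (comp_indV_mk_one_intertwines φ π σ e g) a

/-- **The translates `σ(h) W₀`, `h ∈ H`, span `W`** (`W = ⊕_{s ∈ H/φ(G)} s W₀`, Serre §3.3).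
[cite: SerreLinearRepresentations1977, §3.3] -/
theorem iSup_map_range_comp_indV_mk_one :
    (⨆ h : H, (LinearMap.range (e.toLinearEquiv.symm.toLinearMap ∘ₗ IndV.mk φ π 1)).map (σ h))
      = ⊤ := by
  have hmap : ∀ h : H,
      (LinearMap.range (e.toLinearEquiv.symm.toLinearMap ∘ₗ IndV.mk φ π 1)).map (σ h) =
        (LinearMap.range (IndV.mk φ π h⁻¹)).map e.toLinearEquiv.symm.toLinearMap := by
    intro h
    apply le_antisymm
    · rintro _ ⟨_, ⟨a, rfl⟩, rfl⟩
      refine ⟨IndV.mk φ π h⁻¹ a, ⟨a, rfl⟩, ?_⟩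
      change e.toLinearEquiv.symm (IndV.mk φ π h⁻¹ a) =
        σ h (e.toLinearEquiv.symm (IndV.mk φ π 1 a))
      rw [← equiv_symm_apply_apply, ind_mk, one_mul]
    · rintro _ ⟨_, ⟨a, rfl⟩, rfl⟩
      refine ⟨e.toLinearEquiv.symm (IndV.mk φ π 1 a), ⟨a, rfl⟩, ?_⟩
      change σ h (e.toLinearEquiv.symm (IndV.mk φ π 1 a)) =
        e.toLinearEquiv.symm (IndV.mk φ π h⁻¹ a)
      rw [← equiv_symm_apply_apply, ind_mk, one_mul]
  simp_rw [hmap, ← Submodule.map_iSup]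
  rw [eq_top_iff]
  rintro w -
  refine ⟨e.toLinearEquiv w, ?_, e.toLinearEquiv.symm_apply_apply w⟩
  have htop : (⨆ h : H, LinearMap.range (IndV.mk (k := k) φ π h⁻¹)) = ⊤ := by
    rw [eq_top_iff, ← iSup_range_indV_mk_out φ π, iSup_le_iff]
    intro q
    exact le_iSup_of_le q.out⁻¹ (by rw [inv_inv])
  rw [htop]
  trivial

/-- The `G`-map `i : A → W` of an induced representation is injective (for `φ` injective).
[cite: SerreLinearRepresentations1977, §7.1] -/
theorem comp_indV_mk_one_injective (hφ : Function.Injective φ) :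
    Function.Injective (e.toLinearEquiv.symm.toLinearMap ∘ₗ IndV.mk φ π 1) :=
  e.toLinearEquiv.symm.injective.comp (indV_mk_injective φ π hφ 1)

/-- **Serre's dimension count** for `σ ≃ Ind π`: `dim W = [H : φ(G)] · dim W₀`, `W₀ = i(A)`.
[cite: SerreLinearRepresentations1977, §3.3] -/
theorem finrank_eq_index_mul_finrank_range (hφ : Function.Injective φ) [FiniteDimensional k A]
    [φ.range.FiniteIndex] :
    Module.finrank k W = φ.range.index * Module.finrank k
      (LinearMap.range (e.toLinearEquiv.symm.toLinearMap ∘ₗ IndV.mk φ π 1)) := by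
  rw [LinearMap.finrank_range_of_inj (comp_indV_mk_one_injective φ π σ e hφ),
    e.toLinearEquiv.finrank_eq, finrank_indV_eq φ π hφ]

/-- **Transport of Euler factors along `i : A ≅ W₀`.**  For a subgroup `J ≤ φ(G)` of `H` and
`x ∈ G`, the characteristic polynomial of `π(x)` on `A^{φ⁻¹(J)}` equals that of `σ(φ x)` on
`W₀ ∩ W^J` (`W₀ = i(A)`), whenever both restrictions make sense.
[cite: NeukirchANT1999, VII (10.4) (iv), proof ("Conjugating by τᵢ, we obtain …")] -/
theorem charpoly_restrict_comap_eq (hφ : Function.Injective φ) [FiniteDimensional k A]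
    [FiniteDimensional k W] (J : Subgroup H) (hJ : J ≤ φ.range) (x : G)
    (hx : Set.MapsTo (π x) ↑(Representation.invariants (π.comp (J.comap φ).subtype))
      ↑(Representation.invariants (π.comp (J.comap φ).subtype)))
    (hx' : Set.MapsTo (σ (φ x))
      ↑(LinearMap.range (e.toLinearEquiv.symm.toLinearMap ∘ₗ IndV.mk φ π 1) ⊓
        Representation.invariants (σ.comp J.subtype))
      ↑(LinearMap.range (e.toLinearEquiv.symm.toLinearMap ∘ₗ IndV.mk φ π 1) ⊓
        Representation.invariants (σ.comp J.subtype))) :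
    ((π x).restrict hx).charpoly = ((σ (φ x)).restrict hx').charpoly := by
  set i := e.toLinearEquiv.symm.toLinearMap ∘ₗ IndV.mk φ π 1 with hi
  have hinj : Function.Injective i := comp_indV_mk_one_injective φ π σ e hφ
  have hint : ∀ g a, i (π g a) = σ (φ g) (i a) := fun g a =>
    LinearMap.congr_fun (comp_indV_mk_one_intertwines φ π σ e g) a
  set AJ := Representation.invariants (π.comp (J.comap φ).subtype) with hAJ
  set WJ := LinearMap.range i ⊓ Representation.invariants (σ.comp J.subtype) with hWJ
  -- the forward map `A^{φ⁻¹ J} → W₀ ∩ W^J`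
  have hmem : ∀ a ∈ AJ, i a ∈ WJ := by
    intro a ha
    refine Submodule.mem_inf.mpr ⟨⟨a, rfl⟩, ?_⟩
    rw [Representation.mem_invariants]
    rintro ⟨j, hj⟩
    obtain ⟨g, rfl⟩ := hJ hj
    change σ (φ g) (i a) = i a
    rw [← hint]
    congr 1
    exact (Representation.mem_invariants _ _).mp ha ⟨g, Subgroup.mem_comap.mpr hj⟩
  let F : AJ →ₗ[k] WJ := (i ∘ₗ AJ.subtype).codRestrict WJ fun a => hmem a a.2
  have hFinj : Function.Injective F := by
    intro a b hab
    apply Subtype.ext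
    apply hinj
    simpa [F] using congrArg Subtype.val hab
  have hFsurj : Function.Surjective F := by
    rintro ⟨w, ⟨a, rfl⟩, hw⟩
    refine ⟨⟨a, ?_⟩, rfl⟩
    rw [Representation.mem_invariants]
    rintro ⟨g, hg⟩
    apply hinj
    change i (π g a) = i a
    rw [hint]
    exact (Representation.mem_invariants _ _).mp hw ⟨φ g, Subgroup.mem_comap.mp hg⟩
  let E : AJ ≃ₗ[k] WJ := LinearEquiv.ofBijective F ⟨hFinj, hFsurj⟩
  have hconj : E.conj ((π x).restrict hx) = (σ (φ x)).restrict hx' := by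
    apply LinearMap.ext
    intro w
    obtain ⟨a, rfl⟩ := E.surjective w
    rw [LinearEquiv.conj_apply_apply, LinearEquiv.symm_apply_apply]
    apply Subtype.ext
    change i (π x a) = σ (φ x) (i a)
    exact hint x a
  rw [← hconj, LinearEquiv.charpoly_conj]

end SerreDatum

end Literature.RepresentationTheory.FiniteGroups
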